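import Summits.CriticalPhenomena.LaceExpansionHighD.MeanFieldD10CertRev2
import HarnessLib

/-!
# The hypotheses of the `d = 10` record `MeanFieldD10CertRev2`, inequality by inequality (cell pub-lace10, typer seat)

HONEST FRAMING.  This module adds NO mathematics and NO number.  It takes the two ANALYTIC binders of the landed conditional
certificate `MeanFieldD10CertRev2` (p321303, cell pub-lace7) —
`hI : NobleInitialInputsOf 𝒮₇ BiRev2 biRev2` and `hS : RemValid 10 18 R18 → NobleImprovementInputsOf 𝒮₇ cMuRev2 cWeightsRev2 GammaRev2 BoRev2 boRev2`,
`𝒮₇ = nobleTripleSnoc 10 (1, 17, {0})` — and UNFOLDS them, by the tree definitions `NobleInitialInputsOf`, `NobleImprovementInputsOf`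
(`NobleInstantiateFamily`), `NobleSimplifiedFormAt` (`GaussianDominationRouteNobleAnalysis`) and `NobleWeightedDiagramBoundOf`, into a finite list of
NAMED `Prop`s, ONE PER INEQUALITY, each carrying the literal constant of the record's tables (`BiRev2`, `BoRev2`, `biRev2`, `boRev2`, `GammaRev2`,
`cMuRev2`, `cWeightsRev2`) and a `[cite:]` LOCATOR of the printed display whose shape it instantiates.  The theorems `initRows_iff` and
`stepRows_iff` prove that the conjunction of the named rows IS the record's binder (pure unfolding: `Iff`), and `meanField_d10_Rev2_of_rows` is
the record theorem restated over the rows.  Nothing is discharged: every row below is a HYPOTHESIS about bond percolation on `ℤ¹⁰` exactly as in the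
record; the rows are the statements an engine / referee certifies AGAINST (cell pub-lace10 PLAN §0, Level R), not statements proved here.
The numerals are the record's (outputs of lace7's engines, outward roundings of certified intervals), NOT quantities printed by Fitzner–van der
Hofstad; no sentence of this module is a claim about any dimension.  Companion typing sheet with the printed statements verbatim and journal
pages: cell HOME `run/shared/lean/pub/pub-lace10/typed/CONDITIONS.md` (rows R-I.k / R-Γ.i / R-S.k below = its §1).

SOURCES (journal numbering; re-read for this module from the open-access journal PDFs):
* [GEN] = `FitznerVanDerHofstad2016NoBLE`: R. Fitzner, R. van der Hofstad, *Generalized approach to the non-backtracking lace expansion*,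
  Probab. Theory Relat. Fields **169** (2017) 1041–1119 — bootstrap functions (2.1)–(2.3) p. 1057, the index set `𝒮` p. 1058, Assumption 2.2
  (2.5) p. 1058, Assumption 2.7 (2.8)–(2.13) p. 1059, Def. 2.9 (2.14)–(2.16) and Thm 2.10 p. 1060, Prop. 2.11 p. 1061, the simplified rewrite
  (1.35)–(1.37) p. 1050, Lemma 3.1 (3.1) pp. 1064–1065, `ℋ^{n,l}_z` (3.10)–(3.11) p. 1067, (3.31) p. 1070, (3.87) p. 1079.  (Older tree docstrings
  cite the bootstrap functions as "(2.5)–(2.7)": an earlier arXiv numbering of the same displays.)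
* [EJP] = `FitznerVanDerHofstad2017`: R. Fitzner, R. van der Hofstad, *Mean-field behavior for nearest-neighbor percolation in `d > 10`*,
  Electron. J. Probab. **22** (2017) no. 43 — `μ̄_p = p`, `μ_p` (2.18) p. 10 and p. 15, Prop. 2.2 p. 11, `f₁, f₂, f₃` (2.31)–(2.33) p. 12, `𝒮` (2.35)
  and claims (i)–(iii) p. 13 (`p_I = 1/(2d−1)`), Prop. 2.4 p. 14.  (Tree docstrings cite the arXiv-extended numbering (2.19)–(2.23).)

## Contents (namespace `Summit.CriticalPhenomena.LaceExpansionHighD.D10`)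
* `famRev2` = `𝒮₇`, with the seven evaluation lemmas `famRev2_0 … famRev2_6`; `coe_nbwThresholdI_ten : (p_I : ℝ) = 1/19`.
* `FormWitness d p` — the CONSTANT-FREE part of `NobleSimplifiedFormAt d p ·`: the data `(c_Φ, α_Φ, c_F, α_F, ψ, π, λ, R_Φ, R_F)` of the
  simplified rewrite `Ĝ = Φ̂/(1 − F̂)` ([GEN] (1.35)–(1.37)) with the Lemma 3.1 relations and signs.  The eight Assumption-2.7 rows are stated
  about such a witness.
* Initial-point table (namespace `InitRow`; every row a predicate of the point `p`, READ at `p = p_I = nbwThresholdI 10 = 1/19`):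
  `muRatio`, `cPhi`, `alphaPhi`, `alphaF`, `piSum`, `psiSum`, `rPhi`, `rFDelta` (table `BiRev2`), `diag0 … diag6` (table `biRev2`);
  `InitRowsAt p` = their conjunction; `initRows_iff : InitRowsAt p_I ↔ NobleInitialInputsOf 𝒮₇ BiRev2 biRev2`.
* Bootstrap hypothesis at `p` (namespace `GammaRow`): `f1 p`, `f2 p`, `f3 p` (`f_i(p) ≤ Γ_i`, table `GammaRev2`); `gammaRows_iff`.
* Improvement step at `p` (namespace `StepRow`): the same fifteen rows with tables `BoRev2`, `boRev2`; `StepRowsAt p` (the rows at `p` under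
  `p ∈ (p_I, p_c)` and R-Γ.1–3); `stepRows_iff : (∀ p, StepRowsAt p) ↔ NobleImprovementInputsOf 𝒮₇ cMuRev2 cWeightsRev2 GammaRev2 BoRev2 boRev2`.
* `meanField_d10_Rev2_of_rows`, `meanField_full_d10_Rev2_of_rows` — the record's conclusions from `InitRowsAt p_I` and `∀ p, StepRowsAt p`
  (the `RemValid` premise of `hS` being the kernel theorem `RemCertD10.remValid_d10_cs18`, as in the record); `rows_of_binders` (converse).
All rows are PREDICATES (of the point `p`, resp. of a witness `W`), not closed propositions: this module registers no obligation and no fact.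

WHAT IS NOT HERE.  No proof of any row; no new fact, no numeral not already in `MeanFieldD10CertRev2`; the record file is imported and untouched.
-/

noncomputable section

namespace Summit.CriticalPhenomena.LaceExpansionHighD

namespace D10

open Literature.Barriers.CriticalPhenomena Literature.Probability.Percolation
open Literature.Probability.LatticeModels Literature.Probability.FitznerVanDerHofstad2017

/-! ### The family of weighted diagrams and the initial point -/

/-- The seven-diagram family `𝒮₇ = (𝒮 of [EJP] (2.35), (1,17,{0}))` over which the record bootstraps `f₃` (lace7: the six triples of the printed
`𝒮` — with `(1,6,{0})` as [EJP] prints it, [GEN] p. 1058 printing `(1,4,{0})` — plus the weighted-bubble tail coordinate `(1,17,{0})`).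
[cite: FitznerVanDerHofstad2017, (2.35) p. 13 (EJP 22-43)] [cite: FitznerVanDerHofstad2016NoBLE, §2.1 p. 1058 ("𝒮 is some finite set of indices", p. 1057)] -/
abbrev famRev2 : Fin 7 → ℕ × ℕ × Set (Site 10) :=
  nobleTripleSnoc 10 ((1 : ℕ), (17 : ℕ), ({0} : Set (Site 10)))

/-- `𝒮₇(0) = (0, 0, 𝒳)`. [cite: FitznerVanDerHofstad2017, (2.35) p. 13] -/
theorem famRev2_0 : famRev2 0 = (0, 0, calX 10) := rfl
/-- `𝒮₇(1) = (1, 0, 𝒳)`. [cite: FitznerVanDerHofstad2017, (2.35) p. 13] -/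
theorem famRev2_1 : famRev2 1 = (1, 0, calX 10) := rfl
/-- `𝒮₇(2) = (1, 1, 𝒳)`. [cite: FitznerVanDerHofstad2017, (2.35) p. 13] -/
theorem famRev2_2 : famRev2 2 = (1, 1, calX 10) := rfl
/-- `𝒮₇(3) = (1, 2, 𝒳)`. [cite: FitznerVanDerHofstad2017, (2.35) p. 13] -/
theorem famRev2_3 : famRev2 3 = (1, 2, calX 10) := rfl
/-- `𝒮₇(4) = (1, 3, 𝒳)`. [cite: FitznerVanDerHofstad2017, (2.35) p. 13] -/
theorem famRev2_4 : famRev2 4 = (1, 3, calX 10) := rfl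
/-- `𝒮₇(5) = (1, 6, {0})`. [cite: FitznerVanDerHofstad2017, (2.35) p. 13] -/
theorem famRev2_5 : famRev2 5 = (1, 6, ({0} : Set (Site 10))) := rfl
/-- `𝒮₇(6) = (1, 17, {0})` (the added tail coordinate). [cite: FitznerVanDerHofstad2016NoBLE, §2.1 p. 1057 ("𝒮 is some finite set of indices")] -/
theorem famRev2_6 : famRev2 6 = (1, 17, ({0} : Set (Site 10))) := rfl

/-- At `d = 10` the initial point is `p_I = 1/(2d−1) = 1/19`. [cite: FitznerVanDerHofstad2017, §2.4 p. 13 ("p_I = 1/(2d−1)")] [cite: FitznerVanDerHofstad2016NoBLE, Assumption 2.2 (2.5) p. 1058] -/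
theorem coe_nbwThresholdI_ten : ((nbwThresholdI 10 : unitInterval) : ℝ) = 1 / 19 := by
  rw [coe_nbwThresholdI (by norm_num), nbwThreshold_def]; norm_num

/-- On a singleton `S = {x₀}` the supremum `sup_{x ∈ S} ℋ^{n,l}_p(x)` is the value `ℋ^{n,l}_p(x₀)` (rows `diag5`, `diag6` read `ℋ^{1,6}_p(0)`, `ℋ^{1,17}_p(0)`).
[cite: FitznerVanDerHofstad2016NoBLE, (3.10)–(3.11) p. 1067] -/
theorem nobleSupH_singleton (d n l : ℕ) (x₀ : Site d) (p : unitInterval) :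
    nobleSupH d n l ({x₀} : Set (Site d)) p = nobleH d n l p x₀ := by
  rw [nobleSupH, ciSup_unique]; rfl

/-! ### The constant-free structure of the simplified NoBLE form -/

/-- **The data of the simplified NoBLE rewrite at `p`, without any constant.**  Reals `c_Φ, α_Φ, c_F, α_F` and summable `R_Φ, R_F : ℤ^d → ℝ` with
`τ̂_p(k)(1 − F̂(k)) = Φ̂(k)` on `[−π,π]^d`, `F̂ = c_F + α_F D̂ + R̂_F`, `Φ̂ = c_Φ + α_Φ D̂ + R̂_Φ` (the rewrite (1.35)–(1.37): `Ĝ_z = Φ̂_z/(1 − F̂_z)`);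
reals `ψ = Ψ̂^ι_p(0)`, `π = Σ_κ Π̂^{ι,κ}_p(0)` and `λ = λ_p` with `μ_p = (1+π)λ/(1+ψ(1+λ))`, `F̂(0) = 2dλ/(1+λ)` (Lemma 3.1), `0 ≤ λ`, `(2d−1)λ < 1`
(proof of Lemma 3.2: "λ_z < (2d−1)⁻¹"), and the sign `0 ≤ c_Φ` (Assumption 2.7(a): `β̲_{c,Φ} > 0`, only the sign being consumed).  These are exactly the
constant-free conjuncts of the tree's `NobleSimplifiedFormAt d p B`; the constant-carrying conjuncts are the rows below.
[cite: FitznerVanDerHofstad2016NoBLE, (1.35)–(1.37) p. 1050; Lemma 3.1 (3.1) pp. 1064–1065; Lemma 3.2 (proof) p. 1065; Assumption 2.7 (a) p. 1059]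
[cite: FitznerVanDerHofstad2017, (2.18) p. 10 (μ̄_p = p, μ_p)] -/
structure FormWitness (d : ℕ) (p : unitInterval) where
  /-- `c_{Φ,z}`. -/
  cΦ : ℝ
  /-- `α_{Φ,z}`. -/
  αΦ : ℝ
  /-- `c_{F,z}`. -/
  cF : ℝ
  /-- `α_{F,z}`. -/
  αF : ℝ
  /-- `ψ_z = Ψ̂^ι_z(0) = Σ_x Ψ^κ_z(x)`. -/
  ψ : ℝ
  /-- `π^ι_z = Σ_κ Π̂^{ι,κ}_z(0) = Σ_{x,κ} Π^{ι,κ}_z(x)`. -/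
  π : ℝ
  /-- `λ_z` of Lemma 3.1. -/
  lam : ℝ
  /-- `R_{Φ,z}`. -/
  RΦ : Site d → ℝ
  /-- `R_{F,z}`. -/
  RF : Site d → ℝ
  summable_RΦ : Summable RΦ
  summable_RF : Summable RF
  /-- `τ̂_p(k)(1 − F̂(k)) = Φ̂(k)` on the Brillouin zone. -/
  identity : ∀ k ∈ cube d, tauHat d p k * (1 - (cF + αF * Dhat d k + cosFT RF k)) = cΦ + αΦ * Dhat d k + cosFT RΦ k
  /-- Lemma 3.1: `μ_p = (1+π)λ/(1+ψ(1+λ))`. -/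
  mu_eq : nobleMu d p = (1 + π) * lam / (1 + ψ * (1 + lam))
  /-- Lemma 3.1: `F̂(0) = 2dλ/(1+λ)`. -/
  F_zero : cF + αF + cosFT RF 0 = 2 * d * lam / (1 + lam)
  lam_nonneg : 0 ≤ lam
  lam_lt : (2 * d - 1) * lam < 1
  cΦ_nonneg : 0 ≤ cΦ

/-! ### Rows at the initial point `p_I = 1/19` (binder `hI`; table `BiRev2`, `biRev2`) -/

namespace InitRow

/-- **R-I.1** `μ̄_p/μ_p ≤ β_μ` with `β_μ = BiRev2.βμ`, stated as `p ≤ 1.00337334885495263 · μ_p` (`μ̄_p = p`; read at `p = p_I`).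
[cite: FitznerVanDerHofstad2016NoBLE, Assumption 2.7 (a) (2.8) p. 1059 (at z = z_I by its closing sentence)] [cite: FitznerVanDerHofstad2017, (2.18) p. 10] -/
def muRatio (p : unitInterval) : Prop := (p : ℝ) ≤ 1.00337334885495263 * nobleMu 10 p

/-- **R-I.2** `c_{Φ,z} ≤ β̄_{c,Φ}` with `β̄_{c,Φ} = BiRev2.cΦup = 1`. [cite: FitznerVanDerHofstad2016NoBLE, Assumption 2.7 (a) (2.8) p. 1059] -/
def cPhi {p : unitInterval} (W : FormWitness 10 p) : Prop := W.cΦ ≤ 1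

/-- **R-I.3** `|α_{Φ,z}| ≤ β_{|α,Φ|}` with `β_{|α,Φ|} = BiRev2.βαΦ`. [cite: FitznerVanDerHofstad2016NoBLE, Assumption 2.7 (a) (2.9) p. 1059] -/
def alphaPhi {p : unitInterval} (W : FormWitness 10 p) : Prop := |W.αΦ| ≤ 0.00113707809593999504

/-- **R-I.4** `β̲_{α,F} ≤ α_{F,z}` with `β̲_{α,F} = BiRev2.αFlow`. [cite: FitznerVanDerHofstad2016NoBLE, Assumption 2.7 (a) (2.9) p. 1059] -/
def alphaF {p : unitInterval} (W : FormWitness 10 p) : Prop := 1.04832582360343036 ≤ W.αF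

/-- **R-I.5** `Σ_{x,κ} Π^{ι,κ}_z(x) ≤ β̄_Π` with `β̄_Π = BiRev2.βPi`. [cite: FitznerVanDerHofstad2016NoBLE, Assumption 2.7 (b) (2.10) p. 1059] -/
def piSum {p : unitInterval} (W : FormWitness 10 p) : Prop := W.π ≤ 0.00328222922695166781

/-- **R-I.6** `Σ_x Ψ^κ_z(x) ≥ −β̲_Ψ` with `β̲_Ψ = BiRev2.βΨ`. [cite: FitznerVanDerHofstad2016NoBLE, Assumption 2.7 (b) (2.10) p. 1059] -/
def psiSum {p : unitInterval} (W : FormWitness 10 p) : Prop := -0.00613432418930261752 ≤ W.ψ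

/-- **R-I.7** `Σ_x |R_{Φ,z}(x)| ≤ β_{R,Φ}` with `β_{R,Φ} = BiRev2.βRΦ`. [cite: FitznerVanDerHofstad2016NoBLE, Assumption 2.7 (c) (2.11) p. 1059] -/
def rPhi {p : unitInterval} (W : FormWitness 10 p) : Prop := ∑' x, |W.RΦ x| ≤ 0.0124582256914054894

/-- **R-I.8** `R̂_{F,z}(0) − R̂_{F,z}(k) ≥ −β̲_{ΔR,F}[1 − D̂(k)]` on `[−π,π]¹⁰` with `β̲_{ΔR,F} = BiRev2.βΔ` (initial-point table).
[cite: FitznerVanDerHofstad2016NoBLE, Assumption 2.7 (c) (2.13) p. 1059] -/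
def rFDelta {p : unitInterval} (W : FormWitness 10 p) : Prop :=
  ∀ k ∈ cube 10, -(0.05451641760628133 * (1 - Dhat 10 k)) ≤ cosFT W.RF 0 - cosFT W.RF k

/-- **R-I.9** cell `(0,0,𝒳)`: `sup_{‖x‖₂>1} ℋ^{0,0}_p(x) ≤ biRev2 0` (table `biRev2`, read at `p = p_I`). [cite: FitznerVanDerHofstad2016NoBLE, (3.10)–(3.11) p. 1067 and (3.31) p. 1070] [cite: FitznerVanDerHofstad2017, (2.33), (2.35) pp. 12–13] -/
def diag0 (p : unitInterval) : Prop := nobleSupH 10 0 0 (calX 10) p ≤ 0.0564098664204578571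

/-- **R-I.10** cell `(1,0,𝒳)`: `sup_{‖x‖₂>1} ℋ^{1,0}_p(x) ≤ biRev2 1`. [cite: FitznerVanDerHofstad2016NoBLE, (3.10)–(3.11) p. 1067 and (3.31) p. 1070] [cite: FitznerVanDerHofstad2017, (2.33), (2.35) pp. 12–13] -/
def diag1 (p : unitInterval) : Prop := nobleSupH 10 1 0 (calX 10) p ≤ 0.0905186439061315373

/-- **R-I.11** cell `(1,1,𝒳)`: `sup_{‖x‖₂>1} ℋ^{1,1}_p(x) ≤ biRev2 2`. [cite: FitznerVanDerHofstad2016NoBLE, (3.10)–(3.11) p. 1067 and (3.31) p. 1070] [cite: FitznerVanDerHofstad2017, (2.33), (2.35) pp. 12–13] -/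
def diag2 (p : unitInterval) : Prop := nobleSupH 10 1 1 (calX 10) p ≤ 0.0370777178235925148

/-- **R-I.12** cell `(1,2,𝒳)`: `sup_{‖x‖₂>1} ℋ^{1,2}_p(x) ≤ biRev2 3`. [cite: FitznerVanDerHofstad2016NoBLE, (3.10)–(3.11) p. 1067 and (3.31) p. 1070] [cite: FitznerVanDerHofstad2017, (2.33), (2.35) pp. 12–13] -/
def diag3 (p : unitInterval) : Prop := nobleSupH 10 1 2 (calX 10) p ≤ 0.0249663467112826778

/-- **R-I.13** cell `(1,3,𝒳)`: `sup_{‖x‖₂>1} ℋ^{1,3}_p(x) ≤ biRev2 4`. [cite: FitznerVanDerHofstad2016NoBLE, (3.10)–(3.11) p. 1067 and (3.31) p. 1070] [cite: FitznerVanDerHofstad2017, (2.33), (2.35) pp. 12–13] -/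
def diag4 (p : unitInterval) : Prop := nobleSupH 10 1 3 (calX 10) p ≤ 0.0143289728408067991

/-- **R-I.14** cell `(1,6,{0})`: `ℋ^{1,6}_p(0) ≤ biRev2 5` (as a `sup` over `{0}`; `nobleSupH_singleton`). [cite: FitznerVanDerHofstad2016NoBLE, (3.10)–(3.11) p. 1067 and (3.31) p. 1070] [cite: FitznerVanDerHofstad2017, (2.33), (2.35) pp. 12–13] -/
def diag5 (p : unitInterval) : Prop := nobleSupH 10 1 6 ({0} : Set (Site 10)) p ≤ 0.00689747621648514983

/-- **R-I.15** cell `(1,17,{0})`: `ℋ^{1,17}_p(0) ≤ biRev2 6` (lace7's weighted-bubble tail coordinate; not in the printed `𝒮`).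
[cite: FitznerVanDerHofstad2016NoBLE, (3.10)–(3.11) p. 1067 and §2.1 p. 1057 ("𝒮 is some finite set of indices")] -/
def diag6 (p : unitInterval) : Prop := nobleSupH 10 1 17 ({0} : Set (Site 10)) p ≤ 0.000823379955188092447

end InitRow

/-- **All fifteen initial-point rows at a point `p`** (the binder `hI` is `InitRowsAt p_I`, `initRows_iff`): R-I.1, a constant-free witness `W` at `p`
satisfying R-I.2–R-I.8, and the seven diagram rows R-I.9–R-I.15. [cite: FitznerVanDerHofstad2016NoBLE, Assumption 2.7 p. 1059 (closing sentence, z = z_I) and §3.3.3 p. 1070] [cite: FitznerVanDerHofstad2017, §2.4 claim (ii) p. 13] -/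
def InitRowsAt (p : unitInterval) : Prop :=
  InitRow.muRatio p ∧
    (∃ W : FormWitness 10 p, InitRow.cPhi W ∧ InitRow.alphaPhi W ∧ InitRow.alphaF W ∧ InitRow.piSum W ∧
      InitRow.psiSum W ∧ InitRow.rPhi W ∧ InitRow.rFDelta W) ∧
    (InitRow.diag0 p ∧ InitRow.diag1 p ∧ InitRow.diag2 p ∧ InitRow.diag3 p ∧ InitRow.diag4 p ∧ InitRow.diag5 p ∧ InitRow.diag6 p)

/-! ### The bootstrap hypothesis `f_i(p) ≤ Γ_i` (table `GammaRev2`) -/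

namespace GammaRow

/-- **R-Γ.1** `f₁(p) ≤ Γ₁ = 1.0155`, `f₁(p) = max{(2d−1)p, c_μ(2d−1)μ_p}` with `c_μ = cMuRev2`.
[cite: FitznerVanDerHofstad2016NoBLE, (2.1) p. 1057 and Assumption 2.7 p. 1059 ("f_i(z) ≤ Γ_i")] [cite: FitznerVanDerHofstad2017, (2.31) p. 12] -/
def f1 (p : unitInterval) : Prop := nobleF1 10 cMuRev2 p ≤ 1.0155

/-- **R-Γ.2** `f₂(p) ≤ Γ₂ = 1.166876692803335…`, `f₂(p) = (2d−1)/(2d−2) · sup_k [1 − D̂(k)]|τ̂_p(k)|`.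
[cite: FitznerVanDerHofstad2016NoBLE, (2.2) p. 1057 and Assumption 2.7 p. 1059] [cite: FitznerVanDerHofstad2017, (2.32) p. 12] -/
def f2 (p : unitInterval) : Prop := nobleF2 10 p ≤ 1.166876692803335371520383185088449

/-- **R-Γ.3** `f₃^{𝒮₇}(p) ≤ Γ₃ = 1`, `f₃ = max_{k} sup_{x ∈ S_k} ℋ^{n_k,l_k}_p(x)/c_k` with `c = cWeightsRev2`.
[cite: FitznerVanDerHofstad2016NoBLE, (2.3) p. 1057 and Assumption 2.7 p. 1059] [cite: FitznerVanDerHofstad2017, (2.33) p. 12] -/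
def f3 (p : unitInterval) : Prop := nobleFOf famRev2 cMuRev2 cWeightsRev2 2 p ≤ 1

end GammaRow

/-- The bootstrap hypothesis `∀ i, f_i(p) ≤ Γ_i` at `Γ = GammaRev2` IS the three rows R-Γ.1–R-Γ.3. [cite: FitznerVanDerHofstad2016NoBLE, Assumption 2.7 p. 1059] -/
theorem gammaRows_iff (p : unitInterval) :
    (∀ i, nobleFOf famRev2 cMuRev2 cWeightsRev2 i p ≤ GammaRev2 i) ↔ GammaRow.f1 p ∧ GammaRow.f2 p ∧ GammaRow.f3 p := by
  constructor
  · intro h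
    refine ⟨?_, ?_, ?_⟩
    · have h0 := h 0
      simp only [nobleFOf_zero, GammaRev2, Matrix.cons_val_zero] at h0
      exact h0
    · have h1 := h 1
      simp only [nobleFOf_one, GammaRev2, Matrix.cons_val_one] at h1
      exact h1
    · have h2 := h 2
      simp only [GammaRev2, Matrix.cons_val] at h2
      exact h2
  · rintro ⟨h0, h1, h2⟩ i
    fin_cases i
    · simp only [nobleFOf_zero, GammaRev2, Fin.zero_eta, Matrix.cons_val_zero]
      exact h0
    · simp only [nobleFOf_one, GammaRev2, Fin.mk_one, Matrix.cons_val_one]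
      exact h1
    · simp only [GammaRev2, Fin.reduceFinMk, Matrix.cons_val]
      exact h2

/-! ### Rows of the improvement step at `p ∈ (p_I, p_c)` under `f ≤ Γ` (binder `hS′`; tables `BoRev2`, `boRev2`) -/

namespace StepRow

/-- **R-S.1** `μ̄_p/μ_p ≤ β_μ` with `β_μ = BoRev2.βμ`, as `p ≤ 1.00357728922405944 · μ_p`.
[cite: FitznerVanDerHofstad2016NoBLE, Assumption 2.7 (a) (2.8) p. 1059] [cite: FitznerVanDerHofstad2017, (2.18) p. 10] -/
def muRatio (p : unitInterval) : Prop := (p : ℝ) ≤ 1.00357728922405944 * nobleMu 10 p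

/-- **R-S.2** `c_{Φ,z} ≤ β̄_{c,Φ} = BoRev2.cΦup = 1`. [cite: FitznerVanDerHofstad2016NoBLE, Assumption 2.7 (a) (2.8) p. 1059] -/
def cPhi {p : unitInterval} (W : FormWitness 10 p) : Prop := W.cΦ ≤ 1

/-- **R-S.3** `|α_{Φ,z}| ≤ β_{|α,Φ|} = BoRev2.βαΦ`. [cite: FitznerVanDerHofstad2016NoBLE, Assumption 2.7 (a) (2.9) p. 1059] -/
def alphaPhi {p : unitInterval} (W : FormWitness 10 p) : Prop := |W.αΦ| ≤ 0.00125955752523332896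

/-- **R-S.4** `β̲_{α,F} = BoRev2.αFlow ≤ α_{F,z}`. [cite: FitznerVanDerHofstad2016NoBLE, Assumption 2.7 (a) (2.9) p. 1059] -/
def alphaF {p : unitInterval} (W : FormWitness 10 p) : Prop := 1.04782448441448255 ≤ W.αF

/-- **R-S.5** `Σ_{x,κ} Π^{ι,κ}_z(x) ≤ β̄_Π = BoRev2.βPi`. [cite: FitznerVanDerHofstad2016NoBLE, Assumption 2.7 (b) (2.10) p. 1059] -/
def piSum {p : unitInterval} (W : FormWitness 10 p) : Prop := W.π ≤ 0.00357399103484696697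

/-- **R-S.6** `Σ_x Ψ^κ_z(x) ≥ −β̲_Ψ`, `β̲_Ψ = BoRev2.βΨ`. [cite: FitznerVanDerHofstad2016NoBLE, Assumption 2.7 (b) (2.10) p. 1059] -/
def psiSum {p : unitInterval} (W : FormWitness 10 p) : Prop := -0.00766552831986701905 ≤ W.ψ

/-- **R-S.7** `Σ_x |R_{Φ,z}(x)| ≤ β_{R,Φ} = BoRev2.βRΦ`. [cite: FitznerVanDerHofstad2016NoBLE, Assumption 2.7 (c) (2.11) p. 1059] -/
def rPhi {p : unitInterval} (W : FormWitness 10 p) : Prop := ∑' x, |W.RΦ x| ≤ 0.0148325601103032213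

/-- **R-S.8** `R̂_{F,z}(0) − R̂_{F,z}(k) ≥ −β̲_{ΔR,F}[1 − D̂(k)]` on `[−π,π]¹⁰`, `β̲_{ΔR,F} = BoRev2.βΔ`. [cite: FitznerVanDerHofstad2016NoBLE, Assumption 2.7 (c) (2.13) p. 1059] -/
def rFDelta {p : unitInterval} (W : FormWitness 10 p) : Prop :=
  ∀ k ∈ cube 10, -(0.125760652781583574 * (1 - Dhat 10 k)) ≤ cosFT W.RF 0 - cosFT W.RF k

/-- **R-S.9** cell `(0,0,𝒳)`: `sup_{‖x‖₂>1} ℋ^{0,0}_p(x) ≤ boRev2 0`. [cite: FitznerVanDerHofstad2016NoBLE, (3.10)–(3.11) p. 1067 and (3.87) p. 1079] [cite: FitznerVanDerHofstad2017, Prop. 2.2 p. 11 and (2.33), (2.35) pp. 12–13] -/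
def diag0 (p : unitInterval) : Prop := nobleSupH 10 0 0 (calX 10) p ≤ 0.234045308106334039

/-- **R-S.10** cell `(1,0,𝒳)`: `sup_{‖x‖₂>1} ℋ^{1,0}_p(x) ≤ boRev2 1`. [cite: FitznerVanDerHofstad2016NoBLE, (3.10)–(3.11) p. 1067 and (3.87) p. 1079] [cite: FitznerVanDerHofstad2017, Prop. 2.2 p. 11 and (2.33), (2.35) pp. 12–13] -/
def diag1 (p : unitInterval) : Prop := nobleSupH 10 1 0 (calX 10) p ≤ 0.410645199305664754

/-- **R-S.11** cell `(1,1,𝒳)`: `sup_{‖x‖₂>1} ℋ^{1,1}_p(x) ≤ boRev2 2`. [cite: FitznerVanDerHofstad2016NoBLE, (3.10)–(3.11) p. 1067 and (3.87) p. 1079] [cite: FitznerVanDerHofstad2017, Prop. 2.2 p. 11 and (2.33), (2.35) pp. 12–13] -/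
def diag2 (p : unitInterval) : Prop := nobleSupH 10 1 1 (calX 10) p ≤ 0.175968375487373811

/-- **R-S.12** cell `(1,2,𝒳)`: `sup_{‖x‖₂>1} ℋ^{1,2}_p(x) ≤ boRev2 3`. [cite: FitznerVanDerHofstad2016NoBLE, (3.10)–(3.11) p. 1067 and (3.87) p. 1079] [cite: FitznerVanDerHofstad2017, Prop. 2.2 p. 11 and (2.33), (2.35) pp. 12–13] -/
def diag3 (p : unitInterval) : Prop := nobleSupH 10 1 2 (calX 10) p ≤ 0.14300229108789515

/-- **R-S.13** cell `(1,3,𝒳)`: `sup_{‖x‖₂>1} ℋ^{1,3}_p(x) ≤ boRev2 4`. [cite: FitznerVanDerHofstad2016NoBLE, (3.10)–(3.11) p. 1067 and (3.87) p. 1079] [cite: FitznerVanDerHofstad2017, Prop. 2.2 p. 11 and (2.33), (2.35) pp. 12–13] -/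
def diag4 (p : unitInterval) : Prop := nobleSupH 10 1 3 (calX 10) p ≤ 0.081171683267030848

/-- **R-S.14** cell `(1,6,{0})`: `ℋ^{1,6}_p(0) ≤ boRev2 5`. [cite: FitznerVanDerHofstad2016NoBLE, (3.10)–(3.11) p. 1067 and (3.87) p. 1079] [cite: FitznerVanDerHofstad2017, Prop. 2.2 p. 11 and (2.33), (2.35) pp. 12–13] -/
def diag5 (p : unitInterval) : Prop := nobleSupH 10 1 6 ({0} : Set (Site 10)) p ≤ 0.0359188116144255499

/-- **R-S.15** cell `(1,17,{0})`: `ℋ^{1,17}_p(0) ≤ boRev2 6` (lace7's weighted-bubble tail coordinate).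
[cite: FitznerVanDerHofstad2016NoBLE, (3.10)–(3.11) p. 1067 and §2.1 p. 1057 ("𝒮 is some finite set of indices")] -/
def diag6 (p : unitInterval) : Prop := nobleSupH 10 1 17 ({0} : Set (Site 10)) p ≤ 0.00476325990377930924

end StepRow

/-- **The improvement-step rows at a point `p`** (the binder `hS′`, once its `RemValid` premise is fed the kernel theorem `remValid_d10_cs18`, is
`∀ p, StepRowsAt p`, `stepRows_iff`): if `p` lies in the open interval `(p_I, p_c)` and the three bootstrap rows R-Γ.1–3 hold at `p`, then row R-S.1,
a constant-free witness `W` at `p` satisfying R-S.2–R-S.8, and the seven diagram rows R-S.9–R-S.15.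
[cite: FitznerVanDerHofstad2016NoBLE, Assumption 2.7 p. 1059 ("Assume that z ∈ (z_I, z_c) is such that f_i(z) ≤ Γ_i …") and (3.87) p. 1079] [cite: FitznerVanDerHofstad2017, §2.4 claim (iii) p. 13] -/
def StepRowsAt (p : unitInterval) : Prop :=
  p ∈ Set.Ioo (nbwThresholdI 10) (criticalProbI 10) →
    GammaRow.f1 p → GammaRow.f2 p → GammaRow.f3 p →
      StepRow.muRatio p ∧
        (∃ W : FormWitness 10 p, StepRow.cPhi W ∧ StepRow.alphaPhi W ∧ StepRow.alphaF W ∧ StepRow.piSum W ∧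
          StepRow.psiSum W ∧ StepRow.rPhi W ∧ StepRow.rFDelta W) ∧
        (StepRow.diag0 p ∧ StepRow.diag1 p ∧ StepRow.diag2 p ∧ StepRow.diag3 p ∧ StepRow.diag4 p ∧ StepRow.diag5 p ∧
          StepRow.diag6 p)

/-! ### The rows ARE the binders -/

/-- The simplified form with a table `B` at `p` unfolds into "`p ≤ B.βμ · μ_p` and a constant-free witness obeying the seven remaining Assumption-2.7
inequalities with the constants of `B`" (pure unfolding of `NobleSimplifiedFormAt`). [cite: FitznerVanDerHofstad2016NoBLE, Assumption 2.7 (2.8)–(2.13) p. 1059] -/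
theorem nobleSimplifiedFormAt_ten_iff (p : unitInterval) (B : NobleBeta) :
    NobleSimplifiedFormAt 10 p B ↔
      (p : ℝ) ≤ B.βμ * nobleMu 10 p ∧
        ∃ W : FormWitness 10 p, W.cΦ ≤ B.cΦup ∧ |W.αΦ| ≤ B.βαΦ ∧ B.αFlow ≤ W.αF ∧ W.π ≤ B.βPi ∧ -B.βΨ ≤ W.ψ ∧
          ∑' x, |W.RΦ x| ≤ B.βRΦ ∧ ∀ k ∈ cube 10, -(B.βΔ * (1 - Dhat 10 k)) ≤ cosFT W.RF 0 - cosFT W.RF k := by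
  constructor
  · rintro ⟨cΦ, αΦ, cF, αF, ψ, π, lam, RΦ, RF, hRΦ, hRF, hform, hμ, hF0, hlam0, hlam1, hratio, hcΦ0, hcΦ, hαΦ, hαF, hπ, hψ,
      hRΦle, hRFb⟩
    exact ⟨hratio, ⟨cΦ, αΦ, cF, αF, ψ, π, lam, RΦ, RF, hRΦ, hRF, hform, hμ, hF0, hlam0, hlam1, hcΦ0⟩, hcΦ, hαΦ, hαF, hπ, hψ,
      hRΦle, hRFb⟩
  · rintro ⟨hratio, W, hcΦ, hαΦ, hαF, hπ, hψ, hRΦle, hRFb⟩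
    exact ⟨W.cΦ, W.αΦ, W.cF, W.αF, W.ψ, W.π, W.lam, W.RΦ, W.RF, W.summable_RΦ, W.summable_RF, W.identity, W.mu_eq, W.F_zero,
      W.lam_nonneg, W.lam_lt, hratio, W.cΦ_nonneg, hcΦ, hαΦ, hαF, hπ, hψ, hRΦle, hRFb⟩

/-- A bound on the seven diagrams of `𝒮₇` unfolds into the seven cell rows (pure unfolding of `NobleWeightedDiagramBoundOf` over `Fin 7`).
[cite: FitznerVanDerHofstad2016NoBLE, (3.10)–(3.11) p. 1067] [cite: FitznerVanDerHofstad2017, (2.35) p. 13] -/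
theorem nobleWeightedDiagramBoundOf_famRev2_iff (p : unitInterval) (b : Fin 7 → ℝ) :
    NobleWeightedDiagramBoundOf famRev2 p b ↔
      nobleSupH 10 0 0 (calX 10) p ≤ b 0 ∧ nobleSupH 10 1 0 (calX 10) p ≤ b 1 ∧ nobleSupH 10 1 1 (calX 10) p ≤ b 2 ∧
        nobleSupH 10 1 2 (calX 10) p ≤ b 3 ∧ nobleSupH 10 1 3 (calX 10) p ≤ b 4 ∧
          nobleSupH 10 1 6 ({0} : Set (Site 10)) p ≤ b 5 ∧ nobleSupH 10 1 17 ({0} : Set (Site 10)) p ≤ b 6 := by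
  constructor
  · intro h
    exact ⟨h 0, h 1, h 2, h 3, h 4, h 5, h 6⟩
  · rintro ⟨h0, h1, h2, h3, h4, h5, h6⟩ k
    fin_cases k
    · exact h0
    · exact h1
    · exact h2
    · exact h3
    · exact h4
    · exact h5
    · exact h6

/-- **The fifteen initial-point rows ARE the binder `hI` of the record** (unfolding only).
[cite: FitznerVanDerHofstad2016NoBLE, Assumption 2.7 p. 1059 and §3.3.3 p. 1070] [cite: FitznerVanDerHofstad2017, §2.4 claim (ii) p. 13] -/
theorem initRows_iff : InitRowsAt (nbwThresholdI 10) ↔ NobleInitialInputsOf famRev2 BiRev2 biRev2 := by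
  unfold InitRowsAt NobleInitialInputsOf
  rw [nobleSimplifiedFormAt_ten_iff, nobleWeightedDiagramBoundOf_famRev2_iff]
  simp only [InitRow.muRatio, InitRow.cPhi, InitRow.alphaPhi, InitRow.alphaF, InitRow.piSum, InitRow.psiSum, InitRow.rPhi,
    InitRow.rFDelta, InitRow.diag0, InitRow.diag1, InitRow.diag2, InitRow.diag3, InitRow.diag4, InitRow.diag5, InitRow.diag6,
    BiRev2, biRev2, Matrix.cons_val, and_assoc]

/-- **The improvement-step rows ARE the binder `NobleImprovementInputsOf 𝒮₇ cMuRev2 cWeightsRev2 GammaRev2 BoRev2 boRev2` of the record**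
(unfolding only). [cite: FitznerVanDerHofstad2016NoBLE, Assumption 2.7 p. 1059 and (3.87) p. 1079] [cite: FitznerVanDerHofstad2017, §2.4 claim (iii) p. 13] -/
theorem stepRows_iff :
    (∀ p, StepRowsAt p) ↔ NobleImprovementInputsOf famRev2 cMuRev2 cWeightsRev2 GammaRev2 BoRev2 boRev2 := by
  unfold StepRowsAt NobleImprovementInputsOf
  refine forall_congr' fun p => forall_congr' fun _ => ?_
  rw [gammaRows_iff, nobleSimplifiedFormAt_ten_iff, nobleWeightedDiagramBoundOf_famRev2_iff]
  simp only [StepRow.muRatio, StepRow.cPhi, StepRow.alphaPhi, StepRow.alphaF, StepRow.piSum, StepRow.psiSum, StepRow.rPhi,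
    StepRow.rFDelta, StepRow.diag0, StepRow.diag1, StepRow.diag2, StepRow.diag3, StepRow.diag4, StepRow.diag5, StepRow.diag6,
    BoRev2, boRev2, Matrix.cons_val, and_assoc, and_imp]

/-! ### The record's conclusions over the rows -/

/-- **The record theorem `meanField_d10_Rev2` with its binders spelled as rows**: the fifteen initial-point rows and the improvement-step rows give
the triangle condition, `θ(p_c) = 0` and `β = 1` on `ℤ¹⁰` — CONDITIONAL on those rows exactly as the record is on `hI`/`hS′` (the `RemValid 10 18 R18`
premise of `hS′` is the kernel theorem `RemCertD10.remValid_d10_cs18`). [cite: FitznerVanDerHofstad2017, Thm. 1.1 and Cor. 1.3 (shape of the conclusion)] -/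
theorem meanField_d10_Rev2_of_rows (hI : InitRowsAt (nbwThresholdI 10)) (hS : ∀ p, StepRowsAt p) :
    TriangleCondition 10 ∧ PercolationContinuity 10 ∧ BetaEqOneBoundedRatio 10 :=
  meanField_d10_Rev2 (initRows_iff.1 hI) fun _ => stepRows_iff.1 hS

/-- Full mean-field behaviour `MeanField 10` from the rows (conditional, as above). [cite: FitznerVanDerHofstad2017, Thm. 1.1 and Cor. 1.3 (shape of the conclusion)] -/
theorem meanField_full_d10_Rev2_of_rows (hI : InitRowsAt (nbwThresholdI 10)) (hS : ∀ p, StepRowsAt p) : MeanField 10 :=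
  meanField_full_d10_Rev2 (initRows_iff.1 hI) fun _ => stepRows_iff.1 hS

/-- Conversely the record's binders give the rows (so the two hypothesis lists are interchangeable). [folklore] -/
theorem rows_of_binders (hI : NobleInitialInputsOf famRev2 BiRev2 biRev2)
    (hS : NobleImprovementInputsOf famRev2 cMuRev2 cWeightsRev2 GammaRev2 BoRev2 boRev2) :
    InitRowsAt (nbwThresholdI 10) ∧ ∀ p, StepRowsAt p :=
  ⟨initRows_iff.2 hI, stepRows_iff.2 hS⟩

end D10

end Summit.CriticalPhenomena.LaceExpansionHighD

end
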